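import Summits.QuantumAdvantage.AdviceFreeQNC0.NPGamma37Slicing
import HarnessLib

/-!
# Cell qa-qnc0 — rung (NP-Γ) `RingHardSparse3` (sparse-coupling hardness at `p = 3`, any degree): Part III-b — two-bit calculus (E0) and span induction (E1)/(E2).

Planner qa-qnc0-p2 gen 34 (INBOX P2-34c/P2-34d, memo HOME/qa-qnc0-p2/ROUND-34P2.md §4.4); split of the kernel-checked
monolith `HOME/qa-qnc0-p2/line34/NPGammaProof37.lean` (rc 0, 0 sorries, axioms propext/Classical.choice/Quot.sound) into
≤ 400-line parts `NPGamma37{Slicing,Span,Family,Assembly,Sparse}.lean`.  Part I (𝔽₄ Kraft + sparsity) and the 𝔽₄/ℤ₃ algebra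
are IMPORTED from the landed (NP₁) files `AffBells37{Kraft,Sparse,Resonance}`, Part II (the insulator-involution resonance
MGF (R′)) from the landed `Resonance37G` — identical declarations, opened by name below.

THIS FILE: pair flips and the interpolation coefficients (`flip_sub`: the pair-flip increment is `slope cA cB cAB`), and
`SA_IA_of_mem_span`: slice-affinity (SA) and coefficient invariance (IA) of every polynomial in the span of an insulated
support family, by `Submodule.span_induction`.

THEOREM (NP-Γ, file `NPGamma37Sparse`): for `n ≥ 200`, every strategy `P : Fin n → CubeFn (ZMod 3) n` with all outputs in
`span {mono S : S ∈ 𝓢}`, `𝓢` admitting `8·log₂ n` insulated windows (`NPGamma37.InsulatedWindows`), satisfies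
`#{x odd : Rel x (P · x = 1)} ≤ (1 − n^{−6})·2^{n−1}` — no degree hypothesis.  Supports crux stmt-QuantumAdvantage-22907
(dense coupling — the residual core of `RingHardOdd 3` — is NOT touched).
-/

noncomputable section

namespace Summit.QuantumAdvantage.AdviceFreeQNC0.NPGamma37Proof

open Finset F4
open Classical
open Summit.QuantumAdvantage.AdviceFreeQNC0.AffBells37 (expo chiZ exists_ne_one_of_mass_lt ev L sparse sparse_ne_one
  two_pow_L_le ωz ωz_zero ωz_add ωz_natCast ωz_sq lin chiZ_eq_ωz lin_add lin_mul lin_single ιF_xor ιF_decide_eq_zero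
  ιF_eq_omega ιF_ringWinU)
open Summit.QuantumAdvantage.AdviceFreeQNC0.Resonance37G (four_orbit_le orbit_mgf sg bt sg_not slope_eq no_three
  blockCpl blockCpl_blockCpl blockCpl_involutive blockCpl_apply_of_not_mem uExt_blockCpl xN xN_eq_xOfU xN_blockCpl_of_ne
  xN_blockCpl_left xN_blockCpl_right Inv letter resonance_windows)
-- `wt` (weight of a cube-restricted character) is written `AffBells37.wt` throughout: the bare name would resolve to the
-- walk-word weight `Summit.QuantumAdvantage.AdviceFreeQNC0.wt` of `Elimination.lean`.

variable {F : ℕ}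

section Slicing

open Literature.Computability.QuantumComplexity Literature.Computability.QuantumComplexity.RingHLF
open Literature.Computability.MetaComplexity
open AffBells23 AffBells26

variable {n : ℕ}

/-! ### Two-bit calculus (E0): pair flips and the interpolation coefficients -/

variable {N : ℕ}

/-- overwrite the pattern bits at positions `s, t`. -/
def setAB (x : Fin N → Bool) (s t : ℕ) (bA bB : Bool) : Fin N → Bool :=
  fun i => if i.val = s then bA else if i.val = t then bB else x i

/-- flip one pattern bit. -/
def flip1 (x : Fin N → Bool) (c : ℕ) : Fin N → Bool := fun i => if i.val = c then !x i else x i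

/-- flip the two pattern bits `s, t`. -/
def flip2 (x : Fin N → Bool) (s t : ℕ) : Fin N → Bool := fun i => if i.val = s ∨ i.val = t then !x i else x i

/-- A double flip at `s ≠ t` is two single flips. -/
theorem flip2_eq_flip1_flip1 (x : Fin N → Bool) {s t : ℕ} (hst : s ≠ t) : flip2 x s t = flip1 (flip1 x s) t := by
  funext i; unfold flip2 flip1
  by_cases hs : i.val = s <;> by_cases ht : i.val = t <;> simp [hs, ht] <;> omega

/-- the interpolation coefficients of `Q` in the pair `(s, t)` at background `x`. -/
def cA (Q : Smolensky.CubeFn (ZMod 3) N) (s t : ℕ) (x : Fin N → Bool) : ZMod 3 :=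
  Q (setAB x s t true false) - Q (setAB x s t false false)
/-- the `x_B`-coefficient of `Q` on the pair `(s,t)`: `Q(0,1) − Q(0,0)` with the other bits frozen. -/
def cB (Q : Smolensky.CubeFn (ZMod 3) N) (s t : ℕ) (x : Fin N → Bool) : ZMod 3 :=
  Q (setAB x s t false true) - Q (setAB x s t false false)
/-- the `x_A x_B`-coefficient of `Q` on the pair `(s,t)`: `Q(1,1) − Q(1,0) − Q(0,1) + Q(0,0)`. -/
def cAB (Q : Smolensky.CubeFn (ZMod 3) N) (s t : ℕ) (x : Fin N → Bool) : ZMod 3 :=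
  Q (setAB x s t true true) - Q (setAB x s t true false) - Q (setAB x s t false true) + Q (setAB x s t false false)

/-- Setting the pair bits to their current values does nothing. -/
theorem setAB_self (x : Fin N → Bool) {s t : ℕ} (hs : s < N) (ht : t < N) (_hst : s ≠ t) :
    setAB x s t (x ⟨s, hs⟩) (x ⟨t, ht⟩) = x := by
  funext i; unfold setAB
  by_cases h1 : i.val = s
  · rw [if_pos h1]; congr 1; exact Fin.ext h1.symm
  · rw [if_neg h1]
    by_cases h2 : i.val = t
    · rw [if_pos h2]; congr 1; exact Fin.ext h2.symm
    · rw [if_neg h2]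

/-- A double flip sets both pair bits to their negations. -/
theorem flip2_eq_setAB (x : Fin N → Bool) {s t : ℕ} (hs : s < N) (ht : t < N) (_hst : s ≠ t) :
    flip2 x s t = setAB x s t (!x ⟨s, hs⟩) (!x ⟨t, ht⟩) := by
  funext i; unfold flip2 setAB
  by_cases h1 : i.val = s
  · rw [if_pos (Or.inl h1), if_pos h1]; congr 2; exact Fin.ext h1
  · by_cases h2 : i.val = t
    · rw [if_pos (Or.inr h2), if_neg h1, if_pos h2]; congr 2; exact Fin.ext h2
    · rw [if_neg (by tauto), if_neg h1, if_neg h2]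

/-- **(E0)** the pair-flip increment is the `slope` of the interpolation coefficients. -/
theorem flip_sub (Q : Smolensky.CubeFn (ZMod 3) N) (x : Fin N → Bool) {s t : ℕ} (hs : s < N) (ht : t < N)
    (hst : s ≠ t) :
    Q (flip2 x s t) - Q x = Resonance37G.slope (cA Q s t x) (cB Q s t x) (cAB Q s t x) (x ⟨s, hs⟩) (x ⟨t, ht⟩) := by
  have hx : Q x = Q (setAB x s t (x ⟨s, hs⟩) (x ⟨t, ht⟩)) := by rw [setAB_self x hs ht hst]
  rw [flip2_eq_setAB x hs ht hst, hx]
  unfold cA cB cAB Resonance37G.slope sg bt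
  cases x ⟨s, hs⟩ <;> cases x ⟨t, ht⟩ <;>
    simp only [Bool.not_false, Bool.not_true, if_true, if_false, Bool.false_eq_true] <;>
    generalize Q (setAB x s t true true) = vTT <;> generalize Q (setAB x s t true false) = vTF <;>
    generalize Q (setAB x s t false true) = vFT <;> generalize Q (setAB x s t false false) = vFF <;>
    revert vTT vTF vFT vFF <;> decide

/-- an overwritten position may be flipped first. -/
theorem setAB_flip1_of_mem (x : Fin N → Bool) {s t c : ℕ} (hc : c = s ∨ c = t) (bA bB : Bool) :
    setAB (flip1 x c) s t bA bB = setAB x s t bA bB := by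
  funext i; unfold setAB flip1
  by_cases h1 : i.val = s
  · rw [if_pos h1, if_pos h1]
  · rw [if_neg h1, if_neg h1]
    by_cases h2 : i.val = t
    · rw [if_pos h2, if_pos h2]
    · rw [if_neg h2, if_neg h2, if_neg (by omega)]

/-- `cA` is unchanged by a flip inside the pair. -/
theorem cA_flip1_of_mem (Q : Smolensky.CubeFn (ZMod 3) N) (x : Fin N → Bool) {s t c : ℕ} (hc : c = s ∨ c = t) :
    cA Q s t (flip1 x c) = cA Q s t x := by unfold cA; rw [setAB_flip1_of_mem x hc, setAB_flip1_of_mem x hc]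
/-- `cB` is unchanged by a flip inside the pair. -/
theorem cB_flip1_of_mem (Q : Smolensky.CubeFn (ZMod 3) N) (x : Fin N → Bool) {s t c : ℕ} (hc : c = s ∨ c = t) :
    cB Q s t (flip1 x c) = cB Q s t x := by unfold cB; rw [setAB_flip1_of_mem x hc, setAB_flip1_of_mem x hc]
/-- `cAB` is unchanged by a flip inside the pair. -/
theorem cAB_flip1_of_mem (Q : Smolensky.CubeFn (ZMod 3) N) (x : Fin N → Bool) {s t c : ℕ} (hc : c = s ∨ c = t) :
    cAB Q s t (flip1 x c) = cAB Q s t x := by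
  unfold cAB; rw [setAB_flip1_of_mem x hc, setAB_flip1_of_mem x hc, setAB_flip1_of_mem x hc, setAB_flip1_of_mem x hc]

/-! ### (E1)/(E2): slice-affinity and coefficient invariance of sparse polynomials, by span induction -/

/-- monomials depend only on the coordinates in their support. -/
theorem mono_congr' (S : Finset (Fin N)) {x y : Fin N → Bool} (h : ∀ i ∈ S, x i = y i) :
    Smolensky.mono (ZMod 3) S x = Smolensky.mono (ZMod 3) S y := by
  unfold Smolensky.mono
  exact prod_congr rfl fun i hi => by rw [h i hi]

/-- support `S` meets window `j`. -/
def Meets (p : ℕ → ℕ) (S : Finset (Fin N)) (j : Fin F) : Prop := ∃ i ∈ S, i.val = p j ∨ i.val = p j + 1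

/-- (H1′) no support meets two windows. -/
def H1' (p : ℕ → ℕ) (F : ℕ) (𝓢 : Set (Finset (Fin N))) : Prop :=
  ∀ S ∈ 𝓢, ∀ j j' : Fin F, j ≠ j' → Meets p S j → ¬ Meets p S j'

/-- (H2′) a support containing an insulator meets no window. -/
def H2' (p q : ℕ → ℕ) (F : ℕ) (𝓢 : Set (Finset (Fin N))) : Prop :=
  ∀ S ∈ 𝓢, ∀ i ≤ F, (∃ c ∈ S, c.val = q i) → ∀ j : Fin F, ¬ Meets p S j

/-- admissible flip positions: insulators and free bits. -/
def Adm (p q : ℕ → ℕ) (F : ℕ) (c : ℕ) : Prop := (∃ i ≤ F, c = q i) ∨ (∃ j' : Fin F, c = p j' ∨ c = p j' + 1)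

/-- (E1) slice-affinity of `Q` along the window system. -/
def SA (p : ℕ → ℕ) (F : ℕ) (Q : Smolensky.CubeFn (ZMod 3) (n + 1)) : Prop :=
  ∀ (a : Fin n → Bool) (v : Fin F → Bool),
    Q (xOfU (U p a v)) = Q (xOfU a) + ∑ j : Fin F, (Q (flip2 (xOfU a) (p j) (p j + 1)) - Q (xOfU a)) * bt (v j)

/-- (E2) invariance of the interpolation coefficients under admissible flips off the pair. -/
def IA (p q : ℕ → ℕ) (F : ℕ) (Q : Smolensky.CubeFn (ZMod 3) N) : Prop :=
  ∀ (j : Fin F) (x : Fin N → Bool) (c : ℕ), Adm p q F c → c ≠ p j → c ≠ p j + 1 →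
    cA Q (p j) (p j + 1) (flip1 x c) = cA Q (p j) (p j + 1) x ∧
    cB Q (p j) (p j + 1) (flip1 x c) = cB Q (p j) (p j + 1) x ∧
    cAB Q (p j) (p j + 1) (flip1 x c) = cAB Q (p j) (p j + 1) x

/-- (E1) Under `H1'`, every monomial of the support family is slice-affine. -/
theorem SA_mono {p : ℕ → ℕ} (hS : Sep n F p) {𝓢 : Set (Finset (Fin (n + 1)))} (h1 : H1' p F 𝓢)
    {S : Finset (Fin (n + 1))} (hSm : S ∈ 𝓢) : SA (n := n) p F (Smolensky.mono (ZMod 3) S) := by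
  intro a v
  set x0 := xOfU a with hx0
  by_cases hm : ∃ j₀ : Fin F, Meets p S j₀
  · obtain ⟨j₀, hj₀⟩ := hm
    -- on `S`, the slice pattern is `x0` flipped in window `j₀` iff `v j₀`
    have hpt : ∀ i ∈ S, xOfU (U p a v) i = (if v j₀ = true then flip2 x0 (p j₀) (p j₀ + 1) else x0) i := by
      intro i hi
      rw [xOfU_U_eq hS]
      by_cases hex : ∃ j : Fin F, (i.val = p j ∨ i.val = p j + 1) ∧ v j = true
      · rw [if_pos hex]
        obtain ⟨j, hj, hvj⟩ := hex
        have hjj : j = j₀ := by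
          by_contra hne
          exact h1 S hSm j j₀ hne ⟨i, hi, hj⟩ hj₀
        subst hjj
        rw [if_pos hvj]
        unfold flip2
        rw [if_pos hj]
      · rw [if_neg hex]
        by_cases hv : v j₀ = true
        · rw [if_pos hv]
          unfold flip2
          rw [if_neg]
          intro hh; exact hex ⟨j₀, hh, hv⟩
        · rw [if_neg hv]
    rw [mono_congr' S hpt, Finset.sum_eq_single j₀]
    · by_cases hv : v j₀ = true
      · simp only [hv, if_true, bt]; ring
      · simp only [hv, if_false, bt, Bool.false_eq_true]; ring
    · intro j _ hj
      have hnm : ¬ Meets p S j := fun hh => h1 S hSm j j₀ hj hh hj₀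
      have heq : ∀ i ∈ S, flip2 x0 (p j) (p j + 1) i = x0 i := by
        intro i hi
        unfold flip2
        rw [if_neg]
        intro hh; exact hnm ⟨i, hi, hh⟩
      rw [mono_congr' S heq, sub_self, zero_mul]
    · intro hh; exact absurd (mem_univ j₀) hh
  · push Not at hm
    have hpt : ∀ i ∈ S, xOfU (U p a v) i = x0 i := by
      intro i hi
      rw [xOfU_U_eq hS, if_neg]
      rintro ⟨j, hj, _⟩
      exact hm j ⟨i, hi, hj⟩
    rw [mono_congr' S hpt]
    have hz : ∀ j : Fin F, (Smolensky.mono (ZMod 3) S (flip2 x0 (p j) (p j + 1)) - Smolensky.mono (ZMod 3) S x0)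
        * bt (v j) = 0 := by
      intro j
      have heq : ∀ i ∈ S, flip2 x0 (p j) (p j + 1) i = x0 i := by
        intro i hi
        unfold flip2
        rw [if_neg]
        intro hh; exact hm j ⟨i, hi, hh⟩
      rw [mono_congr' S heq, sub_self, zero_mul]
    rw [Fintype.sum_congr _ _ hz]
    simp

/-- (E2) Under `H1'`/`H2'`, every monomial of the support family has block-invariant pair coefficients. -/
theorem IA_mono {p q : ℕ → ℕ} {𝓢 : Set (Finset (Fin N))} (h1 : H1' p F 𝓢) (h2 : H2' p q F 𝓢)
    {S : Finset (Fin N)} (hSm : S ∈ 𝓢) : IA p q F (Smolensky.mono (ZMod 3) S) := by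
  intro j x c hadm hc1 hc2
  by_cases hm : Meets p S j
  · -- then `c ∉ S`, so the flip is invisible to `mono S` after any overwrite
    have hcS : ∀ i ∈ S, i.val ≠ c := by
      intro i hi hic
      rcases hadm with ⟨k, hk, hck⟩ | ⟨j', hj'⟩
      · exact h2 S hSm k hk ⟨i, hi, by rw [hic, hck]⟩ j hm
      · have hjj : j' ≠ j := by rintro rfl; rcases hj' with h | h <;> omega
        exact h1 S hSm j' j hjj ⟨i, hi, by rw [hic]; exact hj'⟩ hm
    have heq : ∀ bA bB, Smolensky.mono (ZMod 3) S (setAB (flip1 x c) (p j) (p j + 1) bA bB)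
        = Smolensky.mono (ZMod 3) S (setAB x (p j) (p j + 1) bA bB) := by
      intro bA bB
      refine mono_congr' S fun i hi => ?_
      unfold setAB flip1
      rw [if_neg (hcS i hi)]
    unfold cA cB cAB
    refine ⟨?_, ?_, ?_⟩ <;> simp only [heq]
  · -- the pair is outside `S`: all overwrites are invisible, the coefficients vanish
    have hout : ∀ (y : Fin N → Bool) bA bB, Smolensky.mono (ZMod 3) S (setAB y (p j) (p j + 1) bA bB)
        = Smolensky.mono (ZMod 3) S y := by
      intro y bA bB
      refine mono_congr' S fun i hi => ?_
      unfold setAB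
      rw [if_neg, if_neg]
      · intro hh; exact hm ⟨i, hi, Or.inr hh⟩
      · intro hh; exact hm ⟨i, hi, Or.inl hh⟩
    unfold cA cB cAB
    simp only [hout]
    refine ⟨by ring, by ring, by ring⟩

/-- (E1) and (E2) for every `Q` in the span of the admissible monomials. -/
theorem SA_IA_of_mem_span {p q : ℕ → ℕ} (hS : Sep n F p) {𝓢 : Set (Finset (Fin (n + 1)))}
    (h1 : H1' p F 𝓢) (h2 : H2' p q F 𝓢) {Q : Smolensky.CubeFn (ZMod 3) (n + 1)}
    (hQ : Q ∈ Submodule.span (ZMod 3) (Smolensky.mono (ZMod 3) '' 𝓢)) :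
    SA (n := n) p F Q ∧ IA p q F Q := by
  induction hQ using Submodule.span_induction with
  | mem Q hQ =>
    obtain ⟨S, hSm, rfl⟩ := hQ
    exact ⟨SA_mono hS h1 hSm, IA_mono h1 h2 hSm⟩
  | zero =>
    refine ⟨fun a v => by simp, fun j x c _ _ _ => ?_⟩
    unfold cA cB cAB; simp
  | add Q R _ _ hQ hR =>
    refine ⟨fun a v => ?_, fun j x c hadm hc1 hc2 => ?_⟩
    · simp only [Pi.add_apply]
      rw [hQ.1 a v, hR.1 a v]
      have : ∀ j : Fin F, (Q (flip2 (xOfU a) (p j) (p j + 1)) + R (flip2 (xOfU a) (p j) (p j + 1))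
          - (Q (xOfU a) + R (xOfU a))) * bt (v j)
          = (Q (flip2 (xOfU a) (p j) (p j + 1)) - Q (xOfU a)) * bt (v j)
            + (R (flip2 (xOfU a) (p j) (p j + 1)) - R (xOfU a)) * bt (v j) := fun j => by ring
      rw [Fintype.sum_congr _ _ this, sum_add_distrib]
      ring
    · obtain ⟨qA, qB, qAB⟩ := hQ.2 j x c hadm hc1 hc2
      obtain ⟨rA, rB, rAB⟩ := hR.2 j x c hadm hc1 hc2
      unfold cA cB cAB at *
      simp only [Pi.add_apply]
      refine ⟨by linear_combination qA + rA, by linear_combination qB + rB, by linear_combination qAB + rAB⟩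
  | smul r Q _ hQ =>
    refine ⟨fun a v => ?_, fun j x c hadm hc1 hc2 => ?_⟩
    · simp only [Pi.smul_apply, smul_eq_mul]
      rw [hQ.1 a v, mul_add, mul_sum]
      congr 1
      exact sum_congr rfl fun j _ => by ring
    · obtain ⟨qA, qB, qAB⟩ := hQ.2 j x c hadm hc1 hc2
      unfold cA cB cAB at *
      simp only [Pi.smul_apply, smul_eq_mul]
      refine ⟨by linear_combination r * qA, by linear_combination r * qB, by linear_combination r * qAB⟩



end Slicing

end Summit.QuantumAdvantage.AdviceFreeQNC0.NPGamma37Proof
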